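import Literature.AlgebraicGeometry.ShimuraVarieties.UnitaryCurveSiegelChart
import Literature.AlgebraicGeometry.ShimuraVarieties.UnitaryCurveAuxiliaryComplexStructurePositivity
import Literature.AlgebraicGeometry.ShimuraVarieties.UnitaryCurveAuxiliaryPeriodMap
import Literature.AlgebraicGeometry.ShimuraVarieties.UnitaryCurveAuxiliaryComplexStructureEquivariance
import Literature.AlgebraicGeometry.ShimuraVarieties.UnitaryBallRationalSubconeDensityGeneralRank
import HarnessLib

/-!
# The Siegel chart of the unitary Shimura curve AT DELIGNE'S AUXILIARY COMPLEX STRUCTURE `J_Φ` (E2∕E3 junction)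

Topic `AlgebraicGeometry/ShimuraVarieties`; namespace `Literature.AlgebraicGeometry.ShimuraVarieties.UnitaryCurve`.  THEOREMS ONLY (no `def`, no named
fact, no instance, no notation, no `sorry`).  Cell `hodgecm-mathlib` (D-0151), crux HLiu418 (stmt-HodgeConjecture-24832, `--supports`), sub-line P6a,
E-line `Cruxes/HLiu418/Lines/F0_P6a_PELWitnessE.lean` (GEN heir A-p18 (g31)), socket `stub_E123`; LEAD F0P6-plan (g2) 2026-09-01T22:25:01Z (iii);
A-p17 (g27).  HC_CM is proved only modulo the 2 remaining named inputs (hLiu418 24832, h413 24833) until rung 0 closes; count-neutral.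

WHAT.  ★ E3 `UnitaryCurve.exists_siegelChartGS` (A-p01, p846948) produces the Siegel chart of the curve from an ABSTRACT Hodge-embedding datum
`(J, hJ, hJneg, hJsmul, b, bq, hb, hJrat, hZ)` on the negative cone of `J⋆^τ`.  THIS FILE instantiates it at THE datum of [Deligne1979ShimuraVarieties]
Prop. 2.3.10 ∕ [RapoportSmithlingZhang2020Diagonal] Remark 3.2 (ii)(iii) as typed by E1∕E2∕E2b:
* `J := auxComplexStructureV F τ Φ` (★ E2 A2) for a CM type `Φ ∋ τ` of `L`, `ξ ∈ L` with `Im ρ(ξ) < 0` on `Φ`, and a symplectic frame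
  `F : SymplecticFrameV L (RingHom.id L) Jstar ξ g δ` (★ E1 `…SymplecticModuleV`; existence ★ E1 FILE 5 `exists_symplecticFrameV_integral`);
* `hJ ∕ hJneg :=` ★ E2 A3 `auxComplexStructureV_mem_C0pm ∕ neg_auxComplexStructureV_mem_C0`, whose signature hypothesis `hsig` is DISCHARGED HERE from a
  Sylvester frame `Tᴴ J⋆^τ T = diag(1, −1)` (★ `RationalSubconeGeneralRank.re_hermForm_self_pos_of_orthogonal_of_mem_negCone`; the record's pieces carry
  such a frame: ★ `UnitaryBallUniformisationDatum.signature_τ₁`) — `auxComplexStructureV_mem_C0pm_of_frame`, `neg_auxComplexStructureV_mem_C0_of_frame`;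
* `hJsmul :=` ★ A2 `auxComplexStructureV_smul`; `b, bq := (auxToGspFinV F ∕ auxToGspRatV F).comp (MonoidHom.inl _ _)` (★ E1 `…AdelicV`),
  `hb :=` ★ `gspRationalToFinAdelic_auxToGspRatV`, `hJrat :=` ★ E2b A4 `auxComplexStructureV_hJrat` (A-p14), `hZ :=` ★ E2 C `periodChartV`.
The HEAD `exists_siegelChartGS_auxComplexStructureV` has E3's thirteen-clause conclusion VERBATIM (so that `stub_E123`'s body is: choose `Φ, ξ`, the frame
(E1 FILE 5), a Sylvester frame from the record, the level `N` with `Kc ≤ b⁻¹(K_δ(N))` (★ E1 `…LevelV`), and call this theorem once).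

## References
* [Deligne1979ShimuraVarieties] P. Deligne, *Variétés de Shimura* (1979), Prop. 2.3.10 (PDF p. 32 of Milne's translation).
* [RapoportSmithlingZhang2020Diagonal] M. Rapoport, B. Smithling, W. Zhang, Compos. Math. 156 (2020), Remark 3.2 (ii)(iii), Remark 3.3 p. 10, Prop. 3.7 pp. 13–14.
* [MumfordFogartyKirwan1994] D. Mumford, J. Fogarty, F. Kirwan, *Geometric Invariant Theory* (3rd ed. 1994), Appendix to Ch. 7 §A pp. 234–235.
* [Deligne1971TravauxShimura] P. Deligne, *Travaux de Shimura* (1971), Prop. 1.15 p. 132, 1.14–1.15, 4.11–4.12 pp. 148–149.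
* [Milne2005ShimuraVarieties] J. S. Milne, *Introduction to Shimura varieties* (2005), Lemma 5.13 p. 57, Thm. 5.16, §6 pp. 67–70, Thm. 6.11 p. 74.
* [MurtyRamakrishnan1992] V. K. Murty, D. Ramakrishnan, §5 Lemma B p. 462 (signature `(p,1)`: the orthogonal of a negative vector is positive).
-/

set_option autoImplicit false

noncomputable section

open Function Matrix NumberField IsDedekindDomain CategoryTheory CategoryTheory.Limits AlgebraicGeometry
open scoped Matrix ComplexOrder TensorProduct
open Literature.AlgebraicGeometry.Motives (SchemeOver ComplexPoints AlgPoints specOver CMType)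
open Literature.AlgebraicGeometry.AbelianSchemes (PolarizedAbelianSchemeWithLevel)
open Literature.NumberTheory.Automorphic (siegelUpperHalfSpace)
open Literature.NumberTheory.Automorphic.UnitaryGroup
open Literature.AlgebraicGeometry.ModuliOfAbelianVarieties
open Literature.AlgebraicGeometry.ModuliOfAbelianVarieties.SiegelModuli (C0 jOfSiegel jOfSiegel_mem_C0)

namespace Literature.AlgebraicGeometry.ShimuraVarieties

open UnitaryCanonicalModel
open Literature.AlgebraicGeometry.ShimuraVarieties.UnitaryCanonicalModel.Aux (IsExtAdapted)
open Literature.AlgebraicGeometry.ShimuraVarieties.UnitaryCurve.AuxV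

namespace UnitaryCurve

variable {L : Type} [Field L] [NumberField L] [IsCMField L] {Jstar : Matrix (Fin 2) (Fin 2) L} {τ : L →+* ℂ}
variable {g : ℕ} {δ : Fin g → ℕ} {N : ℕ}

/-! ### §1 The letter-level hypotheses of E2 A3, discharged from the record's data -/

omit [NumberField L] [IsCMField L] in
/-- **Signature `(1,1)` ⇒ E2's `hsig`**: with a Sylvester frame `Tᴴ J⋆^τ T = diag(1, −1)` (`T Ti = 1`), the `J⋆^τ`-orthogonal of a negative vector is
positive (★ `RationalSubconeGeneralRank.re_hermForm_self_pos_of_orthogonal_of_mem_negCone` at `p = 1`, read through ★ `hermForm_starRingEnd`).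
[cite: MurtyRamakrishnan1992, §5 proof of Lemma B (p. 462)] [cite: Milne2005ShimuraVarieties, §6 pp. 68–69] -/
theorem hsig_of_frame {T Ti : Matrix (Fin 2) (Fin 2) ℂ} (hT : Tᴴ * Jstar.map τ * T = signatureMatrix 1) (hTi : T * Ti = 1)
    {v : Fin 2 → ℂ} (hv : v ∈ negCone (Jstar.map τ)) :
    ∀ y : Fin 2 → ℂ, star v ⬝ᵥ (Jstar.map τ *ᵥ y) = 0 → y ≠ 0 → 0 < (star y ⬝ᵥ (Jstar.map τ *ᵥ y)).re := fun y hy hy0 => by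
  have h := RationalSubconeGeneralRank.re_hermForm_self_pos_of_orthogonal_of_mem_negCone (p := 1) hT hTi hv hy0
    (by rw [hermForm_starRingEnd]; exact hy)
  rwa [hermForm_starRingEnd] at h

/-- **`J⋆` hermitian over `L` ⇒ `J⋆^τ` hermitian over `ℂ`** (`τ ∘ c = conj ∘ τ`, Mathlib `IsCMField.complexEmbedding_complexConj`).
[cite: RapoportSmithlingZhang2020Diagonal, §3.1 p. 8] -/
theorem conjTranspose_map_eq_of_isHermitian (hJ : (Jstar.map (IsCMField.complexConj L))ᵀ = Jstar) : (Jstar.map τ)ᴴ = Jstar.map τ := by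
  ext i k
  have h : IsCMField.complexConj L (Jstar k i) = Jstar i k := by
    have h0 := congrFun (congrFun hJ i) k
    rwa [transpose_apply, Matrix.map_apply] at h0
  rw [conjTranspose_apply, Matrix.map_apply, Matrix.map_apply, ← h, IsCMField.complexEmbedding_complexConj L, Complex.star_def]

omit [NumberField L] [IsCMField L] in
/-- `τ ∈ Φ` ⇒ ★ `IsExtAdapted τ (RingHom.id L) Φ`. [cite: Deligne1979ShimuraVarieties, 2.3.9 (PDF p. 32)] -/
theorem isExtAdapted_id_of_mem (Φ : CMType L) (hΦ : τ ∈ Φ.1) : IsExtAdapted τ (RingHom.id L) Φ := by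
  intro ρ hρ
  rw [RingHom.comp_id] at hρ
  rw [hρ]
  exact hΦ

/-- **`J_Φ(v) ∈ C0pm δ = S^±`** on the negative cone, from the record-level data: `J⋆` hermitian, a Sylvester frame at `τ`, positivity off `τ`, `τ ∈ Φ`,
`Im ρ(ξ) < 0` on `Φ` (★ E2 A3 `auxComplexStructureV_mem_C0pm` + `hsig_of_frame`). [cite: Deligne1979ShimuraVarieties, Prop. 2.3.10 (PDF p. 32)]
[cite: Milne2005ShimuraVarieties, §6 pp. 68–70] -/
theorem auxComplexStructureV_mem_C0pm_of_frame {ξ : L} (F : SymplecticFrameV L (RingHom.id L) Jstar ξ g δ) (Φ : CMType L) (hΦ : τ ∈ Φ.1)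
    (hξ : ∀ ρ : Φ.1, (ρ.1 ξ).im < 0) (hJ : (Jstar.map (IsCMField.complexConj L))ᵀ = Jstar)
    (T Ti : Matrix (Fin 2) (Fin 2) ℂ) (hT : Tᴴ * Jstar.map τ * T = signatureMatrix 1) (hTi : T * Ti = 1)
    (hpos : ∀ σ : L →+* ℂ, InfinitePlace.mk σ ≠ InfinitePlace.mk τ → (Jstar.map σ).PosDef)
    (v : Fin 2 → ℂ) (hv : v ∈ negCone (Jstar.map τ)) : auxComplexStructureV F τ Φ v ∈ C0pm δ :=
  auxComplexStructureV_mem_C0pm F τ Φ v (conjTranspose_map_eq_of_isHermitian hJ) hv (hsig_of_frame hT hTi hv) hξ hpos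
    (isExtAdapted_id_of_mem Φ hΦ)

/-- **`−J_Φ(v) ∈ C0 δ`** on the negative cone (same data; ★ E2 A3 `neg_auxComplexStructureV_mem_C0`). [cite: Deligne1979ShimuraVarieties, Prop. 2.3.10 (PDF p. 32)]
[cite: Lange2023AbelianVarietiesComplex, §7.1.2 (7.1)] -/
theorem neg_auxComplexStructureV_mem_C0_of_frame {ξ : L} (F : SymplecticFrameV L (RingHom.id L) Jstar ξ g δ) (Φ : CMType L) (hΦ : τ ∈ Φ.1)
    (hξ : ∀ ρ : Φ.1, (ρ.1 ξ).im < 0) (hJ : (Jstar.map (IsCMField.complexConj L))ᵀ = Jstar)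
    (T Ti : Matrix (Fin 2) (Fin 2) ℂ) (hT : Tᴴ * Jstar.map τ * T = signatureMatrix 1) (hTi : T * Ti = 1)
    (hpos : ∀ σ : L →+* ℂ, InfinitePlace.mk σ ≠ InfinitePlace.mk τ → (Jstar.map σ).PosDef)
    (v : Fin 2 → ℂ) (hv : v ∈ negCone (Jstar.map τ)) : -auxComplexStructureV F τ Φ v ∈ C0 δ :=
  neg_auxComplexStructureV_mem_C0 F τ Φ v (conjTranspose_map_eq_of_isHermitian hJ) hv (hsig_of_frame hT hTi hv) hξ hpos
    (isExtAdapted_id_of_mem Φ hΦ)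

/-- The rational∕adelic square for the `V`-block carrier at trivial torus part: `b(γ_𝔸) = (bq γ)_𝔸` with `b, bq := (auxToGspFinV ∕ auxToGspRatV F) ∘ inl`
(★ `gspRationalToFinAdelic_auxToGspRatV`). [cite: Deligne1979ShimuraVarieties, 2.1.2 (PDF p. 24)] [cite: Milne2005ShimuraVarieties, §5 p. 57] -/
theorem hb_auxToGspFinV_inl {ξ : L} (F : SymplecticFrameV L (RingHom.id L) Jstar ξ g δ)
    (γ : ↥(rational (↥(maximalRealSubfield L)) L (IsCMField.complexConj L) 2 Jstar)) :
    ((auxToGspFinV F).comp (MonoidHom.inl _ _)) (rationalToFinAdelic (↥(maximalRealSubfield L)) L (IsCMField.complexConj L) 2 Jstar γ) =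
      gspRationalToFinAdelic δ (((auxToGspRatV F).comp (MonoidHom.inl _ _)) γ) := by
  rw [MonoidHom.comp_apply, MonoidHom.comp_apply, MonoidHom.inl_apply, MonoidHom.inl_apply, gspRationalToFinAdelic_auxToGspRatV, map_one]

/-! ### §2 The junction: E3's Siegel chart at `J := J_Φ` -/

/-- **THE SIEGEL CHART OF THE UNITARY SHIMURA CURVE AT DELIGNE'S `J_Φ`** (★ E3 `exists_siegelChartGS` at the E2 datum): for `J⋆` hermitian with a
Sylvester frame of signature `(1,1)` at `τ` and positive definite at the other places, a CM type `Φ ∋ τ`, `ξ` with `Im ρ(ξ) < 0` on `Φ`, a symplectic frame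
`F` of type `δ` for `ψ_V = Tr(ξ ᵗx̄ J⋆ y)`, a source level `K ≤ b⁻¹(K_δ(N))` for `b := auxToGspFinV F ∘ inl`, a Siegel fine moduli scheme `𝓜` (`0 < g`,
`δ` a polarisation type, `N ≥ 3`) and the uniformisation fact (U) `hU`: E3's chart with `J := auxComplexStructureV F τ Φ` — pieces, uniformisations,
point map `f`, piece function, PERIOD FUNCTIONS `Z a` (holomorphic, `𝔥_g`-valued), principal representatives, `pts`, `f_mk`, the Shimura-set shadow,
admissibility and classification — conclusion VERBATIM.  Inputs by name: ★ A3 (`hJ`, `hJneg` via §1), ★ A2 `auxComplexStructureV_smul` (`hJsmul`),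
★ `gspRationalToFinAdelic_auxToGspRatV` (`hb`), ★ A4 `auxComplexStructureV_hJrat` (`hJrat`), ★ C `periodChartV` (`hZ`).
[cite: Deligne1979ShimuraVarieties, Prop. 2.3.10 (PDF p. 32)] [cite: RapoportSmithlingZhang2020Diagonal, Remark 3.2 (ii)(iii) pp. 9–10 and Prop. 3.7 pp. 13–14]
[cite: Deligne1971TravauxShimura, Prop. 1.15 p. 132 and 4.11–4.12 pp. 148–149] [cite: Milne2005ShimuraVarieties, Thm. 5.16, Thm. 6.11 p. 74]
[cite: MumfordFogartyKirwan1994, Appendix to Ch. 7 §A pp. 234–235] -/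
theorem exists_siegelChartGS_auxComplexStructureV (hU : siegelModuli_complexUniformisation) (hg : 0 < g) (hδ : IsPolarizationType δ)
    (hN : 3 ≤ N) (𝓜 : SiegelFineModuliScheme g N δ)
    (Φ : CMType L) (hΦ : τ ∈ Φ.1) {ξ : L} (hξ : ∀ ρ : Φ.1, (ρ.1 ξ).im < 0) (F : SymplecticFrameV L (RingHom.id L) Jstar ξ g δ)
    (hJ : (Jstar.map (IsCMField.complexConj L))ᵀ = Jstar)
    (T Ti : Matrix (Fin 2) (Fin 2) ℂ) (hT : Tᴴ * Jstar.map τ * T = signatureMatrix 1) (hTi : T * Ti = 1)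
    (hpos : ∀ σ : L →+* ℂ, InfinitePlace.mk σ ≠ InfinitePlace.mk τ → (Jstar.map σ).PosDef)
    (K : Subgroup ↥(finAdelic (↥(maximalRealSubfield L)) L (IsCMField.complexConj L) 2 Jstar))
    (hle : K ≤ (principalLevelSubgroup δ N).comap ((auxToGspFinV F).comp (MonoidHom.inl _ _))) :
    haveI : IsLocallyNoetherian (specOver ℚ ℂ).left := inferInstanceAs (IsLocallyNoetherian (Spec (CommRingCat.of ℂ)))
    ∃ (Sc : (ZMod N)ˣ → SchemeOver ℂ) (ιc : ∀ c, Sc c ⟶ (Motives.baseChange ℚ ℂ).obj 𝓜.M)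
      (unif : ∀ _c : (ZMod N)ˣ, Matrix (Fin g) (Fin g) ℂ → ComplexPoints (Sc _c))
      (f : ShimuraSetGS L Jstar τ K → ComplexPoints 𝓜.M)
      (piece : ↥(finAdelic (↥(maximalRealSubfield L)) L (IsCMField.complexConj L) 2 Jstar) → (ZMod N)ˣ)
      (Z : ↥(finAdelic (↥(maximalRealSubfield L)) L (IsCMField.complexConj L) 2 Jstar) → (Fin 2 → ℂ) → Matrix (Fin g) (Fin g) ℂ)
      (u : (ZMod N)ˣ → finAdeleQˣ) (rep : (ZMod N)ˣ → ↥(gspFinAdelic δ))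
      (pts : ComplexPoints ((Motives.baseChange ℚ ℂ).obj 𝓜.M) ≃ SiegelShimuraSet δ (principalLevelSubgroup δ N)),
    -- (U1) component cofan of irreducible pieces
      Nonempty (IsColimit (Cofan.mk ((Motives.baseChange ℚ ℂ).obj 𝓜.M) ιc)) ∧
      (∀ c, IrreducibleSpace (Sc c).left) ∧
    -- (U2+) analytic clauses per piece
      (∀ c, ContinuousOn (unif c) (siegelUpperHalfSpace g)) ∧
      (∀ c, IsOpenMap ((siegelUpperHalfSpace g).restrict (unif c))) ∧
      (∀ c, Set.SurjOn (unif c) (siegelUpperHalfSpace g) Set.univ) ∧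
      (∀ c, ∀ W ∈ siegelUpperHalfSpace g, ∀ W' ∈ siegelUpperHalfSpace g,
        unif c W = unif c W' ↔ ∃ M ∈ siegelLevelGroup δ N, ∃ C : (Fin g → ℂ) ≃ₗ[ℂ] (Fin g → ℂ),
          ∀ x : Fin g ⊕ Fin g → ℝ, C (siegelPeriodMap δ W x) = siegelPeriodMap δ W' (intAct M x)) ∧
      (∀ (c : (ZMod N)ˣ) (U : (Sc c).left.affineOpens) (s : (Sc c).left.presheaf.obj (Opposite.op (↑U : (Sc c).left.Opens))),
        DifferentiableOn ℂ (fun W ↦ AlgPoints.evalOrZero (↑U : (Sc c).left.Opens) s (unif c W))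
          (siegelUpperHalfSpace g ∩ unif c ⁻¹' {P | P.pt ∈ (↑U : (Sc c).left.Opens)})) ∧
    -- principal representatives (the five (U3) premisses)
      (∀ c, (∀ w, Valued.v ((u c : finAdeleQ) w) = 1) ∧ (u c : finAdeleQ) - ((c : ZMod N).val : ℕ) ∈ levelIdeal N ∧
        rep c ∈ principalLevelSubgroup δ 1 ∧
          IsMultiplier (typeFormOver δ finAdeleQ) (rep c : GL (Fin g ⊕ Fin g) finAdeleQ) (u c) ∧
            ((rep c : GL (Fin g ⊕ Fin g) finAdeleQ) : Matrix (Fin g ⊕ Fin g) (Fin g ⊕ Fin g) finAdeleQ) =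
              Matrix.fromBlocks 1 0 0 ((u c : finAdeleQ) • (1 : Matrix (Fin g) (Fin g) finAdeleQ))) ∧
    -- (P) the point map: `Z_hol`, `Z_mem`, `f_mk`, the Shimura-set shadow
      (∀ a (i j : Fin g), DifferentiableOn ℂ (fun v => Z a v i j) (negCone (Jstar.map τ))) ∧
      (∀ a (v : Fin 2 → ℂ), v ∈ negCone (Jstar.map τ) → Z a v ∈ siegelUpperHalfSpace g) ∧
      (∀ (v : Fin 2 → ℂ) (hv : v ∈ negCone (Jstar.map τ)) a,
        f (ShimuraSetGS.mk L Jstar τ K v hv a) =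
          (AlgPoints.baseChangeEquiv (algebraMap ℚ ℂ) 𝓜.M).symm (AlgPoints.map (ιc (piece a)) (unif (piece a) (Z a v)))) ∧
      (∀ (v : Fin 2 → ℂ) (hv : v ∈ negCone (Jstar.map τ)) a,
        pts (AlgPoints.baseChangeEquiv (algebraMap ℚ ℂ) 𝓜.M (f (ShimuraSetGS.mk L Jstar τ K v hv a))) =
          SiegelShimuraSet.mk δ (principalLevelSubgroup δ N) ⟨auxComplexStructureV F τ Φ v, auxComplexStructureV_mem_C0pm_of_frame F Φ hΦ hξ hJ T Ti hT hTi hpos v hv⟩ (((auxToGspFinV F).comp (MonoidHom.inl _ _)) a)) ∧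
      (∀ (v : Fin 2 → ℂ) (hv : v ∈ negCone (Jstar.map τ)) a, ∃ hZv : Z a v ∈ siegelUpperHalfSpace g,
        SiegelShimuraSet.mk δ (principalLevelSubgroup δ N) ⟨auxComplexStructureV F τ Φ v, auxComplexStructureV_mem_C0pm_of_frame F Φ hΦ hξ hJ T Ti hT hTi hpos v hv⟩ (((auxToGspFinV F).comp (MonoidHom.inl _ _)) a) =
          SiegelShimuraSet.mk δ (principalLevelSubgroup δ N)
            ⟨jOfSiegel δ (Z a v), C0_subset_C0pm δ (jOfSiegel_mem_C0 hδ.1 hZv)⟩ (rep (piece a))) ∧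
      (∀ (c : (ZMod N)ˣ) (W : Matrix (Fin g) (Fin g) ℂ) (hW : W ∈ siegelUpperHalfSpace g),
        pts (AlgPoints.map (ιc c) (unif c W)) =
          SiegelShimuraSet.mk δ (principalLevelSubgroup δ N) ⟨jOfSiegel δ W, C0_subset_C0pm δ (jOfSiegel_mem_C0 hδ.1 hW)⟩ (rep c)) ∧
    -- (A) admissibility of the universal triple at the image point ((U3∃)) and classification ((U3-D3))
      (∀ (v : Fin 2 → ℂ) (hv : v ∈ negCone (Jstar.map τ)) a, ∃ hZv : Z a v ∈ siegelUpperHalfSpace g,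
        (∃ (P' : PolarizedAbelianSchemeWithLevel g N δ (specOver ℚ ℂ).left)
            (G : P'.A.X.left ⟶ 𝓜.univ.A.X.left) (Ĝ : P'.D.hat.X.left ⟶ 𝓜.univ.D.hat.X.left),
            P'.IsBaseChangeVia 𝓜.univ (f (ShimuraSetGS.mk L Jstar τ K v hv a)).left G Ĝ ∧
              IsAdmissibleAt hδ (rep (piece a)) (Z a v) hZv P') ∧
        ∀ P' : PolarizedAbelianSchemeWithLevel g N δ (specOver ℚ ℂ).left, IsAdmissibleAt hδ (rep (piece a)) (Z a v) hZv P' →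
          f (ShimuraSetGS.mk L Jstar τ K v hv a) = 𝓜.classifyingMap (specOver ℚ ℂ) P') :=
  exists_siegelChartGS hU hg hδ hN 𝓜 (auxComplexStructureV F τ Φ)
    (auxComplexStructureV_mem_C0pm_of_frame F Φ hΦ hξ hJ T Ti hT hTi hpos)
    (neg_auxComplexStructureV_mem_C0_of_frame F Φ hΦ hξ hJ T Ti hT hTi hpos)
    (fun _ hc v _ => auxComplexStructureV_smul F τ Φ v hc)
    ((auxToGspFinV F).comp (MonoidHom.inl _ _)) ((auxToGspRatV F).comp (MonoidHom.inl _ _)) (hb_auxToGspFinV_inl F)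
    (auxComplexStructureV_hJrat F τ Φ (negCone (Jstar.map τ))) K hle
    (fun γ _ hC => periodChartV L F Φ τ hδ.1 γ hC)

end UnitaryCurve

end Literature.AlgebraicGeometry.ShimuraVarieties

end
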